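import Literature.AlgebraicGeometry.Motives.MorphismsToProjectiveSpace
import Mathlib.AlgebraicGeometry.Morphisms.Separated
import HarnessLib

/-!
# A scheme carrying generating sections with AFFINE non-vanishing loci is separated

Layer `Literature/AlgebraicGeometry/Motives`, namespace `Literature.AlgebraicGeometry.Motives.GeneratingSections`.
THEOREMS ONLY (no definition, no named fact, no instance, no notation; net Literature debt **0**).

Let `Y` be a scheme carrying generating-sections data `D : GeneratingSections ι Y` (★
`Motives/MorphismsToProjectiveSpace`: an open cover `U i = Y_{sᵢ}` and ratios `s_j/s_i ∈ Γ(U i, 𝒪_Y)` — the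
chart form of «an invertible sheaf `𝓛` with global sections `sᵢ` generating it», [Hartshorne1977] II Thm. 7.1,
[GortzWedhorn2020] Prop. 13.47) such that every non-vanishing locus `U i` is AFFINE.  Then, for any morphism
`f : Y → Spec k` (`k` any commutative ring — no field, no finiteness, no Noetherian hypothesis, any index type `ι`):

* `isAffineHom_toProj_of_isAffineOpen` — the morphism `Y → ℙ(ι)_k = Proj k[xᵢ : i ∈ ι]` defined by the sections
  (★ `GeneratingSections.toProj`) is AFFINE: `toProj ⁻¹ D₊(xᵢ) = U i` (★ `toProj_preimage_basicOpen`) and affineness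
  is local on the target (Mathlib `HasAffineProperty @IsAffineHom`, [Hartshorne1977] II Ex. 5.17 (a)); this is the
  ring-and-index-general form of ★ `GeneratingSections.isAffineHom_toProj` (`Motives/ToProjFunctionField` :76, stated
  for a field and `ι = Fin (d + 1)`), cf. the proof of [GortzWedhorn2020] Prop. 13.48 («`r⁻¹(D₊(f)) = X_f` and
  `r_f : X_f → D₊(f)` is an isomorphism if `X_f` is affine»);
* `isSeparated_toProj_of_isAffineOpen`, **`isSeparated_of_isAffineOpen_of_commRing`** — hence `toProj` is separated
  (affine morphisms are separated, [Hartshorne1977] II Ex. 5.17 (b) / Mathlib `IsSeparated.of_isAffineHom`) and so is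
  `f = toProj ≫ (ℙ(ι)_k → Spec k)` (★ `toProj_toSpec`; `Proj A → Spec A₀` is separated in Mathlib);
* **`isSeparated_of_isAffineOpen'`** — the base-free form: EVERY morphism `g : Y → S` out of such a `Y` is separated
  (apply the above to `Y → Spec ℤ` and cancel: `g ≫ (S → Spec ℤ)` separated ⇒ `g` separated, [Hartshorne1977] II
  Cor. 4.6 (e) / [EGAI] Prop. 5.5.1 (v), Mathlib `IsSeparated.of_comp`).

This is the sentence «in particular the existence of an ample line bundle on `X` implies that `X` is separated» printed
after [GortzWedhorn2020] Prop. 13.48 (p. 393), with ampleness in the form Prop. 13.47 (iv) (pp. 392–393: finitely many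
sections `fᵢ ∈ Γ(X, 𝓛^{⊗d})` with `X_{fᵢ}` AFFINE covering `X`; [EGAII] Thm. 4.5.2).  The book states 13.47/13.48 for
`X` qcqs with finitely many sections; the Lean statements below need neither hypothesis (any index type, any scheme),
because the proof is the direct one: `Y` is affine over `ℙ(ι)`, which is separated.  It is the «ample-type cover ⇒
separated» step by which [MumfordFogartyKirwan1994] Ch. 3 §2 Thm. 3.8 (pp. 75–76: the invariant sections `D_α` have
affine non-vanishing loci covering `Z₀`) feeds the separatedness of the quotient in Ch. 7 §3 Thm. 7.9 (p. 139) — the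
cell's F-DAG leaf F-8 (8d) on the slice road (consumer named by B-plan1 (g15) 2026-08-30T04:10:14Z (α3)).  The
field-and-finite-type corollary «quasi-projective ⇒ separated» is the sibling `HodgeTheory/QuasiProjectiveSeparatedOfField`.

Cell hodgecm-mathlib (D-0151), fan B, generic capital; typer seat B-typ02 (g14).  HC_CM is proved only modulo the 7
printed citations until rung 0 closes; this file discharges none of them and adds no hypothesis to anything.

## References
* [Hartshorne1977] R. Hartshorne, *Algebraic Geometry* (1977), II Thm. 7.1 (p. 150) and Prop. 7.2 (p. 151), II Ex. 5.17
  (a), (b) (p. 128: affine morphisms; an affine morphism is quasi-compact and separated), II Cor. 4.6 (p. 99).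
* [GortzWedhorn2020] U. Görtz, T. Wedhorn, *Algebraic Geometry I*, 2nd ed. (2020), Prop. 13.47 (pp. 392–393), Prop. 13.48
  and the remark following it (p. 393), Prop. 12.3 (affine morphisms).
* [EGAII] A. Grothendieck, J. Dieudonné, *EGA II* (1961), §1.2–§1.3 (affine morphisms), Thm. 4.5.2; [EGAI] Prop. 5.5.1 (v).
* [MumfordFogartyKirwan1994] D. Mumford, J. Fogarty, F. Kirwan, *Geometric Invariant Theory*, 3rd ed. (1994), Ch. 3 §2
  Thm. 3.8 (pp. 75–76), Ch. 7 §3 Thm. 7.9 (p. 139).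
-/

set_option autoImplicit false

universe u

open CategoryTheory AlgebraicGeometry Limits
open MvPolynomial (X)
open Literature.AlgebraicGeometry.Motives.Segre


noncomputable section

namespace Literature.AlgebraicGeometry.Motives

namespace GeneratingSections

variable {ι : Type} {Y : Scheme.{u}} (D : GeneratingSections ι Y) {k : Type u} [CommRing k]
  (f : Y ⟶ Spec (.of k))

/-- **`Y → ℙ(ι)_k` defined by generating sections with affine non-vanishing loci is an AFFINE morphism** (any
commutative ring `k`, any index type `ι`): `toProj ⁻¹ D₊(xᵢ) = U i = Y_{sᵢ}` is affine by hypothesis, the `D₊(xᵢ)` are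
affine and cover `ℙ(ι)_k`, and affineness is Zariski-local on the target.  (The field / `Fin (d + 1)` case is ★
`GeneratingSections.isAffineHom_toProj`.) [cite: GortzWedhorn2020, Prop. 13.48 (p. 393), proof]
[cite: Hartshorne1977, II Thm. 7.1 (p. 150) and Ex. 5.17 (a) (p. 128)] -/
theorem isAffineHom_toProj_of_isAffineOpen (hU : ∀ i, IsAffineOpen (D.U i)) : IsAffineHom (D.toProj f) := by
  letI : GradedAlgebra (grading ι k) := MvPolynomial.gradedAlgebra
  refine (HasAffineProperty.iff_of_iSup_eq_top (P := @IsAffineHom) (f := D.toProj f)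
    (fun i : ι ↦ ⟨Proj.basicOpen (grading ι k) (X i), Proj.isAffineOpen_basicOpen _ _ (X_mem k i) zero_lt_one⟩)
    (Proj.iSup_basicOpen_eq_top (grading ι k) (fun i : ι ↦ (X i : MvPolynomial ι k))
      (irrelevant_le_span_X ι k))).2 fun i ↦ ?_
  change IsAffineOpen (D.toProj f ⁻¹ᵁ Proj.basicOpen (grading ι k) (X i))
  rw [D.toProj_preimage_basicOpen f i]
  exact hU i

/-- … hence `Y → ℙ(ι)_k` is SEPARATED (affine morphisms are separated). [cite: Hartshorne1977, II Ex. 5.17 (b) (p. 128)] -/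
theorem isSeparated_toProj_of_isAffineOpen (hU : ∀ i, IsAffineOpen (D.U i)) : IsSeparated (D.toProj f) :=
  haveI := D.isAffineHom_toProj_of_isAffineOpen f hU
  inferInstance

omit D f in
variable (ι k) in
/-- **`ℙ(ι)_k = Proj k[xᵢ : i ∈ ι]` is separated over `Spec k`** (any commutative ring `k`, any index type `ι`): the
structure morphism ★ `Segre.toSpec ι k = Proj.toSpecZero ≫ Spec (k → k[x]₀)` is separated (Mathlib: `Proj A → Spec A₀` is
separated; the `Fin (n + 1)`/field case is ★ `Resolution.DeJong1996.isSeparated_toSpec`).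
[cite: GortzWedhorn2020, Prop. 13.5] -/
theorem _root_.Literature.AlgebraicGeometry.Motives.Segre.isSeparated_toSpec : IsSeparated (toSpec ι k) := by
  unfold Literature.AlgebraicGeometry.Motives.Segre.toSpec
  infer_instance

/-- **Generating sections with AFFINE non-vanishing loci ⇒ separated over the base ring**: if a `k`-scheme
`f : Y → Spec k` (`k` any commutative ring) carries generating-sections data `D` — an open cover by the non-vanishing
loci `U i = Y_{sᵢ}` of sections of an invertible sheaf, with their ratios — and every `U i` is AFFINE, then `f` is
separated: `f = toProj ≫ (ℙ(ι)_k → Spec k)` with `toProj` affine.  The «(iv) ⇒ separated» content of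
[GortzWedhorn2020] Prop. 13.47 / 13.48 («the existence of an ample line bundle on `X` implies that `X` is separated»),
and the step of [MumfordFogartyKirwan1994] Thm. 3.8 ⇒ Thm. 7.9 by which the affine invariant charts `Z_{D_α}` make the
quotient separated. [cite: GortzWedhorn2020, Prop. 13.47 (pp. 392–393) and Prop. 13.48 (p. 393)]
[cite: MumfordFogartyKirwan1994, Ch. 3 §2 Theorem 3.8 (pp. 75–76) and Ch. 7 §3 Theorem 7.9 (p. 139)] -/
theorem isSeparated_of_isAffineOpen_of_commRing (hU : ∀ i, IsAffineOpen (D.U i)) : IsSeparated f := by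
  haveI := D.isSeparated_toProj_of_isAffineOpen f hU
  haveI := Segre.isSeparated_toSpec ι k
  rw [← D.toProj_toSpec f]
  infer_instance

omit f in
/-- **Base-free form: a scheme carrying generating sections with affine non-vanishing loci is separated over ANY
base** — every morphism `g : Y → S` is separated (apply `isSeparated_of_isAffineOpen_of_commRing` to `Y → Spec ℤ` and use
that `g ≫ (S → Spec ℤ)` separated forces `g` separated). [cite: GortzWedhorn2020, Prop. 13.48 (p. 393)]
[cite: Hartshorne1977, II Cor. 4.6 (e) (p. 99)] (Noetherian there; in general [EGAI] Prop. 5.5.1 (v)) -/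
theorem isSeparated_of_isAffineOpen' (hU : ∀ i, IsAffineOpen (D.U i)) {S : Scheme.{u}} (g : Y ⟶ S) :
    IsSeparated g := by
  haveI : IsSeparated (g ≫ specULiftZIsTerminal.from S) := by
    rw [specULiftZIsTerminal.hom_ext (g ≫ specULiftZIsTerminal.from S) (specULiftZIsTerminal.from Y)]
    exact D.isSeparated_of_isAffineOpen_of_commRing (specULiftZIsTerminal.from Y) hU
  exact IsSeparated.of_comp g (specULiftZIsTerminal.from S)

end GeneratingSections

end Literature.AlgebraicGeometry.Motives

end
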